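import Literature.NumberTheory.Irrationality.RhinViola1996.PermutationGroupZeta2
import HarnessLib

/-!
# Rhin–Viola 1996, §3: `Φ = ⟨φ, τ, σ⟩ = ⟨φ, τ⟩ ≅ S₅` on the five sums, `|Φ| = 120`, `T ≅ D₅`, `⟨φ, σ⟩ ≅ D₆`, the 12 cosets

Topic `Literature/NumberTheory/Irrationality/RhinViola1996`. PROVED companion (theorems and concrete definitions
only; no named fact, no `sorry`) to `PermutationGroupZeta2.lean` (whose docstring lists `|Φ| = 120` as NOT typed)
and `PermutationGroupZeta2Proofs.lean`; it is the `ζ(2)` analogue of `RhinViola2001/TenSumsPermutations.lean`,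
`…/PermutationGroupOrder.lean`, `…/TenSumsAction.lean`. Source read on the page: G. Rhin, C. Viola, *On a
permutation group related to ζ(2)*, Acta Arith. **77** (1996) 23–56 [RhinViola1996], §3 pp. 37–39 (held text
`paper:doi-10-4064-aa-77-1-23-56`, p0015–p0017) and §2 p. 28.

HONEST FRAMING (cell pub-zeta5): systematic search; no irrationality claim unless certified. Pure finite group
theory and parameter bookkeeping of a 1996 `ζ(2)` paper; nothing here is about `ζ(5)`, a measure or a denominator.

## What is printed (p. 38–39) and how it is typed

"We are interested in the structure of the permutation group `Φ = ⟨φ, τ, σ⟩` generated by `φ, τ` and `σ`. We have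
already remarked that the subgroup `T = ⟨τ, σ⟩` is isomorphic to the dihedral group `D₅` of order 10, and it is easy
to check that `⟨φ, σ⟩` is isomorphic to the dihedral group `D₆` of order 12. Following a remark of Dixon [2], we note
that `φ, τ` and `σ` can be viewed as three permutations of five integers only, i.e. of the five sums
`h+i, i+j, j+k, k+l, l+h`, by defining `φ(h+i) = φ(h) + φ(i)`, etc. In fact, we have the following decompositions into
cycles: `φ = (i+j  l+h)`, `τ = (h+i  i+j  j+k  k+l  l+h)`, `σ = (h+i  j+k)(k+l  l+h)`. Since the symmetric group `S₅` of
the `5! = 120` permutations of five elements is generated by a cyclic permutation of the five elements and a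
transposition, we see that `Φ = ⟨φ, τ, σ⟩ = ⟨φ, τ⟩` is isomorphic to `S₅`. … Since `|Φ| = 120` and `|T| = 10`, there
are 12 left cosets of `T` in `Φ`. … if we apply to (3.5) any product `χ` of integral transformations `φ, τ` and `σ`,
we obtain `I(χ(h), χ(i), χ(j), χ(k), χ(l))/(χ(h)!χ(i)!χ(j)!χ(k)!χ(l)!)`, where `χ` is the corresponding product of
permutations `φ, τ` and `σ` in reverse order. In other words, the above mapping … is an anti-isomorphism. … It is
easy to see that the following elements of `Φ`: (3.7) `ι, φ, τφ, τ²φ, τ³φ, τ⁴φ, φτφ, φτ²φ, φτ³φ, φτ⁴φ, τ²φτφ,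
φτ²φτφ`, where `ι` denotes the identity, … are pairwise left-inequivalent mod `T`, i.e. representatives of all the 12
left cosets of `T` in `Φ`."

TYPED (the five sums numbered `0,…,4` in the printed order `h+i, i+j, j+k, k+l, l+h`): `fiveSums P : Fin 5 → ℤ`;
`phiV = (1 4)`, `tauV = (0 1 2 3 4)`, `sigmaV = (0 2)(3 4) : Equiv.Perm (Fin 5)`; `PhiV = closure {φ,τ,σ}`,
`TV = closure {τ,σ}`, `DSix = closure {φ,σ}`; the three generators `Gen` with `Gen.act` = the tree's `phi`, `tau`,
`sigma` on `Params`, words `act`, and `wordPerm` (product in reverse order); the twelve representatives `rep12`.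
PROVED: equivariance `fiveSums (g.act P) i = fiveSums P (genPerm g i)` (no hypothesis) and for words
(`fiveSums_act`); faithfulness (`eq_of_fiveSums_eq`: `2h = (h+i) − (i+j) + (j+k) − (k+l) + (l+h)` etc.), so words with
the same permutation act identically and CONVERSELY (`wordPerm_eq_iff`, tested at one parameter set); `τ` is a
5-cycle, `φ` a transposition, hence **`PhiV = ⊤`, `closure {φ, τ} = ⊤`, `Nat.card PhiV = 120`**
(Mathlib's `Equiv.Perm.closure_prime_cycle_swap`); every permutation of the five sums is realised by a word
(`exists_word_of_perm`), so the group of parameter transformations `{act w}` is in bijection with `S₅`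
(**`card_range_act : Nat.card (Set.range act) = 120`** — "`Φ` … is isomorphic to `S₅`", `|Φ| = 120`);
`T` = the ten `τ^a σ^b` with `στσ = τ⁻¹` (**`card_TV = 10`**, "`D₅` of order 10") and `T.index = 12` ("12 left
cosets"); `⟨φ, σ⟩` = the twelve `(φσ)^a σ^b`, `φσ` of order 6 (**`card_DSix = 12`**, "`D₆` of order 12"); the twelve
elements (3.7) lie in pairwise distinct left cosets of `T` and every element of `S₅` lies in one of them
(`rep12_pairwise_inequivalent`, `rep12_covers`). Kernel computations only on explicit permutations of five symbols;
the ONE enumeration in the file is the quantification over the 120 elements of `S₅` in `rep12_covers` (`S₅` is small;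
nothing larger is ever enumerated); no `native_decide`.
NOT typed: explicit isomorphisms with Mathlib's `DihedralGroup 5` / `DihedralGroup 6` (order + presentation only);
the twelve transformation formulae p. 39–40 themselves (the tree has (3.3) as `hypergeometric_phi`).
-/

namespace Literature.NumberTheory.Irrationality.RhinViola1996

namespace PhiGroup

open Equiv Equiv.Perm

/-! ### The five sums and the three generators as permutations of them (p. 38) -/

/-- The five sums `h+i, i+j, j+k, k+l, l+h` (entry `0,…,4` in this order). [cite: RhinViola1996, §3 p. 38] -/
def fiveSums (P : Params) : Fin 5 → ℤ := ![P.h + P.i, P.i + P.j, P.j + P.k, P.k + P.l, P.l + P.h]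

/-- `τ = (h+i  i+j  j+k  k+l  l+h)`, the 5-cycle `0 → 1 → 2 → 3 → 4 → 0`. [cite: RhinViola1996, §3 p. 38] -/
def tauV : Perm (Fin 5) where
  toFun := ![1, 2, 3, 4, 0]
  invFun := ![4, 0, 1, 2, 3]
  left_inv x := by fin_cases x <;> rfl
  right_inv x := by fin_cases x <;> rfl

/-- `φ = (i+j  l+h)`. [cite: RhinViola1996, §3 p. 38] -/
def phiV : Perm (Fin 5) := swap 1 4

/-- `σ = (h+i  j+k)(k+l  l+h)`. [cite: RhinViola1996, §3 p. 38] -/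
def sigmaV : Perm (Fin 5) := swap 0 2 * swap 3 4

/-- `Φ = ⟨φ, τ, σ⟩` on the five sums. [cite: RhinViola1996, §3 p. 38] -/
def PhiV : Subgroup (Perm (Fin 5)) := Subgroup.closure {phiV, tauV, sigmaV}

/-- `T = ⟨τ, σ⟩` on the five sums. [cite: RhinViola1996, §2 p. 28, §3 p. 38] -/
def TV : Subgroup (Perm (Fin 5)) := Subgroup.closure {tauV, sigmaV}

/-- `⟨φ, σ⟩` on the five sums. [cite: RhinViola1996, §3 p. 38] -/
def DSix : Subgroup (Perm (Fin 5)) := Subgroup.closure {phiV, sigmaV}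

/-! ### The three generators acting on the parameters, and words -/

/-- The three generators `φ, τ, σ` of `Φ`. [cite: RhinViola1996, §3 p. 38 (`Φ = ⟨φ, τ, σ⟩`)] -/
inductive Gen
  | Phi
  | Tau
  | Sigma
  deriving DecidableEq

/-- The action of a generator on the parameters `(h,i,j,k,l)` (the tree's `phi`, `tau`, `sigma`).
[cite: RhinViola1996, §2 (2.2)–(2.3), §3 (3.3)] -/
def Gen.act : Gen → Params → Params
  | .Phi => phi
  | .Tau => tau
  | .Sigma => sigma

/-- The action of a word `χ` of integral transformations, applied right to left: `(χ(h), …, χ(l))`.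
[cite: RhinViola1996, §3 p. 38] -/
def act (w : List Gen) (P : Params) : Params := w.foldr (fun g Q => g.act Q) P

/-- The permutation of the five sums attached to a generator. [cite: RhinViola1996, §3 p. 38] -/
def genPerm : Gen → Perm (Fin 5)
  | .Phi => phiV
  | .Tau => tauV
  | .Sigma => sigmaV

/-- The values of the three permutations (plumbing). [cite: RhinViola1996, §3 p. 38] -/
theorem genPerm_apply (g : Gen) : ⇑(genPerm g) =
    match g with
    | .Phi => ![0, 4, 2, 3, 1]
    | .Tau => ![1, 2, 3, 4, 0]
    | .Sigma => ![2, 1, 0, 4, 3] := by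
  cases g <;> funext i <;> fin_cases i <;> rfl

/-- "`φ, τ` and `σ` can be viewed as three permutations of five integers only, i.e. of the five sums … by defining
`φ(h+i) = φ(h) + φ(i)`, etc.": equivariance for one generator, `sᵢ(g·P) = s_{π_g(i)}(P)` (no hypothesis on `P`).
[cite: RhinViola1996, §3 p. 38] -/
theorem fiveSums_genAct (g : Gen) (P : Params) (i : Fin 5) : fiveSums (g.act P) i = fiveSums P (genPerm g i) := by
  rw [genPerm_apply]
  cases g <;> fin_cases i <;> simp [fiveSums, Gen.act, phi, tau, sigma] <;> ring

/-- The permutation of the five sums attached to a word `χ = [g₁, …, gₙ]` (applied right to left): "the corresponding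
product of permutations `φ, τ` and `σ` in reverse order", `π_{gₙ} ⋯ π_{g₁}` ("an anti-isomorphism").
[cite: RhinViola1996, §3 p. 38] -/
def wordPerm : List Gen → Perm (Fin 5)
  | [] => 1
  | g :: w => wordPerm w * genPerm g

/-- `wordPerm` of a concatenation. [cite: RhinViola1996, §3 p. 38 ("anti-isomorphism")] -/
theorem wordPerm_append (w w' : List Gen) : wordPerm (w ++ w') = wordPerm w' * wordPerm w := by
  induction w with
  | nil => simp [wordPerm]
  | cons g w ih => simp [wordPerm, ih, mul_assoc]

/-- Equivariance for words. [cite: RhinViola1996, §3 p. 38] -/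
theorem fiveSums_act (w : List Gen) (P : Params) (i : Fin 5) : fiveSums (act w P) i = fiveSums P (wordPerm w i) := by
  induction w generalizing i with
  | nil => rfl
  | cons g w ih =>
    show fiveSums (g.act (act w P)) i = fiveSums P ((wordPerm w * genPerm g) i)
    rw [fiveSums_genAct, ih, Perm.mul_apply]

/-! ### Faithfulness: the five sums determine the parameters -/

/-- `2h = (h+i) − (i+j) + (j+k) − (k+l) + (l+h)` (Dixon's remark: the five sums determine `h, …, l`).
[cite: RhinViola1996, §3 p. 38] -/
theorem two_mul_h_eq (P : Params) :
    2 * P.h = fiveSums P 0 - fiveSums P 1 + fiveSums P 2 - fiveSums P 3 + fiveSums P 4 := by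
  simp [fiveSums]; ring

/-- The five sums determine the five parameters. [cite: RhinViola1996, §3 p. 38] -/
theorem eq_of_fiveSums_eq {P Q : Params} (h : fiveSums P = fiveSums Q) : P = Q := by
  have e := fun i => congrFun h i
  have e0 := e 0; have e1 := e 1; have e2 := e 2; have e3 := e 3; have e4 := e 4
  simp [fiveSums] at e0 e1 e2 e3 e4
  ext <;> omega

/-- Words with the same permutation of the five sums act identically on the parameters. [cite: RhinViola1996, §3 p. 38] -/
theorem act_eq_of_wordPerm_eq {w w' : List Gen} (h : wordPerm w = wordPerm w') (P : Params) :
    act w P = act w' P :=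
  eq_of_fiveSums_eq (funext fun i => by rw [fiveSums_act, fiveSums_act, h])

/-- A parameter set with five distinct sums (plumbing for the converse). [cite: RhinViola1996, §3 p. 38] -/
def testParams : Params := ⟨1, 2, 4, 8, 16⟩

/-- The five sums of `testParams` are pairwise distinct. [cite: RhinViola1996, §3 p. 38] -/
theorem fiveSums_testParams_injective : Function.Injective (fiveSums testParams) := by
  unfold Function.Injective fiveSums testParams; decide

/-- **The anti-isomorphism `χ ↦ χ`** between products of integral transformations and products of permutations:
two words induce the same permutation of the five sums if and only if they act identically on all parameters.
[cite: RhinViola1996, §3 p. 38] -/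
theorem wordPerm_eq_iff (w w' : List Gen) : wordPerm w = wordPerm w' ↔ ∀ P : Params, act w P = act w' P := by
  refine ⟨fun h P => act_eq_of_wordPerm_eq h P, fun h => ?_⟩
  refine Equiv.ext fun i => fiveSums_testParams_injective ?_
  rw [← fiveSums_act, ← fiveSums_act, h]

/-! ### `Φ = ⟨φ, τ, σ⟩ = ⟨φ, τ⟩ ≅ S₅`, `|Φ| = 120` -/

/-- `τ` is the 5-cycle (as `List.formPerm`). [cite: RhinViola1996, §3 p. 38] -/
theorem tauV_eq_formPerm : tauV = List.formPerm [0, 1, 2, 3, 4] := by decide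

/-- "Since the symmetric group `S₅` … is generated by a cyclic permutation of the five elements and a transposition,
… `⟨φ, τ⟩`" is all of `S₅`. [cite: RhinViola1996, §3 p. 38] -/
theorem closure_phiV_tauV : Subgroup.closure {phiV, tauV} = (⊤ : Subgroup (Perm (Fin 5))) := by
  have hcyc : IsCycle tauV := by
    rw [tauV_eq_formPerm]
    exact List.isCycle_formPerm (by decide) (by decide)
  have hsupp : tauV.support = Finset.univ := by decide
  have hswap : IsSwap phiV := ⟨1, 4, by decide, rfl⟩
  have h5 : (Fintype.card (Fin 5)).Prime := by rw [Fintype.card_fin]; norm_num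
  rw [← closure_prime_cycle_swap h5 hcyc hsupp hswap, Set.pair_comm]

/-- **`Φ = ⟨φ, τ, σ⟩ = ⟨φ, τ⟩` is (all of) `S₅`** on the five sums. [cite: RhinViola1996, §3 p. 38] -/
theorem PhiV_eq_top : PhiV = ⊤ := by
  rw [eq_top_iff, ← closure_phiV_tauV]
  exact Subgroup.closure_mono fun x hx => by
    simp only [Set.mem_insert_iff, Set.mem_singleton_iff] at hx ⊢
    tauto

/-- **`|Φ| = 120`**. [cite: RhinViola1996, §3 p. 38 ("Since |Φ| = 120")] -/
theorem card_PhiV : Nat.card PhiV = 120 := by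
  rw [PhiV_eq_top, Subgroup.card_top, Nat.card_eq_fintype_card, Fintype.card_perm, Fintype.card_fin]
  rfl

/-- Every permutation of the five sums is induced by a word in `φ, τ, σ` ("every element of `Φ = ⟨φ, τ⟩` is a
suitable product of permutations each equal to `φ` or to `τ`", p. 39; inverses are positive powers).
[cite: RhinViola1996, §3 pp. 38–39] -/
theorem exists_word_of_perm (π : Perm (Fin 5)) : ∃ w : List Gen, wordPerm w = π := by
  have hπ : π ∈ PhiV := by rw [PhiV_eq_top]; exact Subgroup.mem_top π
  have hpow : ∀ (w : List Gen) (n : ℕ), wordPerm (List.replicate n w).flatten = wordPerm w ^ n := by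
    intro w n
    induction n with
    | zero => simp [wordPerm]
    | succ n ih => rw [List.replicate_succ, List.flatten_cons, wordPerm_append, ih, pow_succ]
  induction hπ using Subgroup.closure_induction with
  | mem x hx =>
    simp only [Set.mem_insert_iff, Set.mem_singleton_iff] at hx
    rcases hx with rfl | rfl | rfl
    · exact ⟨[.Phi], by simp [wordPerm, genPerm]⟩
    · exact ⟨[.Tau], by simp [wordPerm, genPerm]⟩
    · exact ⟨[.Sigma], by simp [wordPerm, genPerm]⟩
  | one => exact ⟨[], rfl⟩
  | mul x y _ _ ihx ihy =>
    obtain ⟨w, rfl⟩ := ihx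
    obtain ⟨w', rfl⟩ := ihy
    exact ⟨w' ++ w, wordPerm_append w' w⟩
  | inv x _ ih =>
    obtain ⟨w, rfl⟩ := ih
    refine ⟨(List.replicate (orderOf (wordPerm w) - 1) w).flatten, ?_⟩
    rw [hpow]
    have ho : 0 < orderOf (wordPerm w) := orderOf_pos _
    have h1 : wordPerm w ^ (orderOf (wordPerm w) - 1) * wordPerm w = 1 := by
      rw [← pow_succ, Nat.sub_add_cancel ho, pow_orderOf_eq_one]
    exact eq_inv_of_mul_eq_one_left h1

/-- **"`Φ` … is isomorphic to `S₅`"**: the group of parameter transformations `{χ = act w}` is in bijection with the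
120 permutations of the five sums, by `act w ↦ wordPerm w` (well defined and injective by `wordPerm_eq_iff`,
onto by `exists_word_of_perm`). [cite: RhinViola1996, §3 p. 38] -/
noncomputable def rangeActEquiv : Set.range act ≃ Perm (Fin 5) where
  toFun f := wordPerm f.2.choose
  invFun π := ⟨act (exists_word_of_perm π).choose, ⟨_, rfl⟩⟩
  left_inv f := by
    apply Subtype.ext
    have h1 : act f.2.choose = f.1 := f.2.choose_spec
    have h2 := (exists_word_of_perm (wordPerm f.2.choose)).choose_spec
    exact (funext ((wordPerm_eq_iff _ _).mp h2)).trans h1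
  right_inv π := by
    have h2 := (exists_word_of_perm π).choose_spec
    have h1 := Exists.choose_spec (⟨_, rfl⟩ : act (exists_word_of_perm π).choose ∈ Set.range act)
    exact ((wordPerm_eq_iff _ _).mpr (congrFun h1)).trans h2

/-- **`|Φ| = 120`** for the group of parameter transformations `χ`. [cite: RhinViola1996, §3 p. 38] -/
theorem card_range_act : Nat.card (Set.range act) = 120 := by
  rw [Nat.card_congr rangeActEquiv, Nat.card_eq_fintype_card, Fintype.card_perm, Fintype.card_fin]
  rfl

/-! ### `T = ⟨τ, σ⟩ ≅ D₅` of order 10 and its 12 left cosets; `⟨φ, σ⟩ ≅ D₆` of order 12 (p. 38) -/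

/-- The ten elements `τ^a σ^b` (`a < 5`, `b < 2`). [cite: RhinViola1996, §2 p. 28 ("D₅ of order 10")] -/
def tauSigma (p : Fin 5 × Fin 2) : Perm (Fin 5) := tauV ^ (p.1 : ℕ) * sigmaV ^ (p.2 : ℕ)

/-- The dihedral relations of `T`: `τ⁵ = 1`, `σ² = 1`, `στσ = τ⁻¹`. [cite: RhinViola1996, §2 p. 28] -/
theorem dihedral_TV : tauV ^ 5 = 1 ∧ sigmaV ^ 2 = 1 ∧ sigmaV * tauV * sigmaV = tauV⁻¹ := by decide

/-- The ten `τ^a σ^b` are closed under products and inverses and pairwise distinct (dihedral normal form).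
[cite: RhinViola1996, §2 p. 28] -/
theorem tauSigma_closed :
    (∀ p q : Fin 5 × Fin 2, ∃ r : Fin 5 × Fin 2, tauSigma p * tauSigma q = tauSigma r) ∧
      (∀ p : Fin 5 × Fin 2, ∃ r : Fin 5 × Fin 2, (tauSigma p)⁻¹ = tauSigma r) ∧ Function.Injective tauSigma := by
  unfold tauSigma Function.Injective; refine ⟨?_, ?_, ?_⟩ <;> decide +kernel

/-- `T` consists exactly of the ten `τ^a σ^b`. [cite: RhinViola1996, §2 p. 28, §3 p. 38] -/
theorem mem_TV_iff (π : Perm (Fin 5)) : π ∈ TV ↔ ∃ p : Fin 5 × Fin 2, tauSigma p = π := by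
  have hτ : tauV ∈ TV := Subgroup.subset_closure (by simp)
  have hσ : sigmaV ∈ TV := Subgroup.subset_closure (by simp)
  let D : Subgroup (Perm (Fin 5)) :=
    { carrier := Set.range tauSigma
      one_mem' := ⟨(0, 0), by simp [tauSigma]⟩
      mul_mem' := by
        rintro _ _ ⟨p, rfl⟩ ⟨q, rfl⟩
        obtain ⟨r, hr⟩ := tauSigma_closed.1 p q
        exact ⟨r, hr.symm⟩
      inv_mem' := by
        rintro _ ⟨p, rfl⟩
        obtain ⟨r, hr⟩ := tauSigma_closed.2.1 p
        exact ⟨r, hr.symm⟩ }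
  have hle : TV ≤ D := by
    rw [TV, Subgroup.closure_le]
    rintro x hx
    simp only [Set.mem_insert_iff, Set.mem_singleton_iff] at hx
    rcases hx with rfl | rfl
    · exact ⟨(1, 0), by simp [tauSigma]⟩
    · exact ⟨(0, 1), by simp [tauSigma]⟩
  constructor
  · intro h; exact hle h
  · rintro ⟨p, rfl⟩
    exact Subgroup.mul_mem _ (Subgroup.pow_mem _ hτ _) (Subgroup.pow_mem _ hσ _)

/-- **"`T = ⟨τ, σ⟩` is isomorphic to the dihedral group `D₅` of order 10"** — typed as: order 10 with the dihedral
presentation `dihedral_TV`. [cite: RhinViola1996, §2 p. 28, §3 p. 38] -/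
theorem card_TV : Nat.card TV = 10 := by
  have hset : (TV : Set (Perm (Fin 5))) = Set.range tauSigma := by
    ext π; rw [SetLike.mem_coe, mem_TV_iff, Set.mem_range]
  rw [← SetLike.coe_sort_coe, hset, ← Nat.card_congr (Equiv.ofInjective tauSigma tauSigma_closed.2.2),
    Nat.card_prod]
  simp

/-- **"Since `|Φ| = 120` and `|T| = 10`, there are 12 left cosets of `T` in `Φ`."** [cite: RhinViola1996, §3 p. 38] -/
theorem index_TV : TV.index = 12 := by
  have h := Subgroup.card_mul_index TV
  rw [card_TV, Nat.card_eq_fintype_card, Fintype.card_perm, Fintype.card_fin] at h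
  have h120 : Nat.factorial 5 = 120 := rfl
  omega

/-- The twelve elements `(φσ)^a σ^b` (`a < 6`, `b < 2`). [cite: RhinViola1996, §3 p. 38 ("D₆ of order 12")] -/
def phiSigmaPow (p : Fin 6 × Fin 2) : Perm (Fin 5) := (phiV * sigmaV) ^ (p.1 : ℕ) * sigmaV ^ (p.2 : ℕ)

/-- The dihedral relations of `⟨φ, σ⟩`: `φσ` has order 6 (`(φσ)⁶ = 1`, `(φσ)², (φσ)³ ≠ 1`), `σ² = φ² = 1`,
`σ(φσ)σ = (φσ)⁻¹`. [cite: RhinViola1996, §3 p. 38] -/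
theorem dihedral_DSix : (phiV * sigmaV) ^ 6 = 1 ∧ (phiV * sigmaV) ^ 2 ≠ 1 ∧ (phiV * sigmaV) ^ 3 ≠ 1 ∧
    phiV ^ 2 = 1 ∧ sigmaV * (phiV * sigmaV) * sigmaV = (phiV * sigmaV)⁻¹ := by
  decide

/-- The twelve `(φσ)^a σ^b` are closed under products and inverses and pairwise distinct.
[cite: RhinViola1996, §3 p. 38] -/
theorem phiSigmaPow_closed :
    (∀ p q : Fin 6 × Fin 2, ∃ r : Fin 6 × Fin 2, phiSigmaPow p * phiSigmaPow q = phiSigmaPow r) ∧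
      (∀ p : Fin 6 × Fin 2, ∃ r : Fin 6 × Fin 2, (phiSigmaPow p)⁻¹ = phiSigmaPow r) ∧
        Function.Injective phiSigmaPow := by
  unfold phiSigmaPow Function.Injective; refine ⟨?_, ?_, ?_⟩ <;> decide +kernel

/-- `⟨φ, σ⟩` consists exactly of the twelve `(φσ)^a σ^b`. [cite: RhinViola1996, §3 p. 38] -/
theorem mem_DSix_iff (π : Perm (Fin 5)) : π ∈ DSix ↔ ∃ p : Fin 6 × Fin 2, phiSigmaPow p = π := by
  have hφ : phiV ∈ DSix := Subgroup.subset_closure (by simp)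
  have hσ : sigmaV ∈ DSix := Subgroup.subset_closure (by simp)
  let D : Subgroup (Perm (Fin 5)) :=
    { carrier := Set.range phiSigmaPow
      one_mem' := ⟨(0, 0), by simp [phiSigmaPow]⟩
      mul_mem' := by
        rintro _ _ ⟨p, rfl⟩ ⟨q, rfl⟩
        obtain ⟨r, hr⟩ := phiSigmaPow_closed.1 p q
        exact ⟨r, hr.symm⟩
      inv_mem' := by
        rintro _ ⟨p, rfl⟩
        obtain ⟨r, hr⟩ := phiSigmaPow_closed.2.1 p
        exact ⟨r, hr.symm⟩ }
  have hle : DSix ≤ D := by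
    rw [DSix, Subgroup.closure_le]
    rintro x hx
    simp only [Set.mem_insert_iff, Set.mem_singleton_iff] at hx
    rcases hx with rfl | rfl
    · refine ⟨(1, 1), ?_⟩
      show (phiV * sigmaV) ^ ((1 : Fin 6) : ℕ) * sigmaV ^ ((1 : Fin 2) : ℕ) = phiV
      decide
    · exact ⟨(0, 1), by simp [phiSigmaPow]⟩
  constructor
  · intro h; exact hle h
  · rintro ⟨p, rfl⟩
    exact Subgroup.mul_mem _ (Subgroup.pow_mem _ (Subgroup.mul_mem _ hφ hσ) _) (Subgroup.pow_mem _ hσ _)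

/-- **"it is easy to check that `⟨φ, σ⟩` is isomorphic to the dihedral group `D₆` of order 12"** — typed as:
order 12 with the dihedral presentation `dihedral_DSix`. [cite: RhinViola1996, §3 p. 38] -/
theorem card_DSix : Nat.card DSix = 12 := by
  have hset : (DSix : Set (Perm (Fin 5))) = Set.range phiSigmaPow := by
    ext π; rw [SetLike.mem_coe, mem_DSix_iff, Set.mem_range]
  rw [← SetLike.coe_sort_coe, hset, ← Nat.card_congr (Equiv.ofInjective phiSigmaPow phiSigmaPow_closed.2.2),
    Nat.card_prod]
  simp

/-! ### The twelve representatives (3.7) of the left cosets of `T` in `Φ` -/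

/-- The twelve elements (3.7): `ι, φ, τφ, τ²φ, τ³φ, τ⁴φ, φτφ, φτ²φ, φτ³φ, φτ⁴φ, τ²φτφ, φτ²φτφ`
(products of PERMUTATIONS, composed right to left). [cite: RhinViola1996, §3 (3.7), p. 39] -/
def rep12 : Fin 12 → Perm (Fin 5) :=
  ![1, phiV, tauV * phiV, tauV ^ 2 * phiV, tauV ^ 3 * phiV, tauV ^ 4 * phiV, phiV * tauV * phiV,
    phiV * tauV ^ 2 * phiV, phiV * tauV ^ 3 * phiV, phiV * tauV ^ 4 * phiV, tauV ^ 2 * phiV * tauV * phiV,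
    phiV * tauV ^ 2 * phiV * tauV * phiV]

/-- The elements (3.7) "are pairwise left-inequivalent mod `T`": `χ_a⁻¹ χ_b ∉ T` for `a ≠ b`.
[cite: RhinViola1996, §3 p. 39] -/
theorem rep12_pairwise_inequivalent :
    ∀ a b : Fin 12, a ≠ b → ∀ p : Fin 5 × Fin 2, (rep12 a)⁻¹ * rep12 b ≠ tauSigma p := by
  unfold rep12 tauSigma; decide +kernel

/-- … "i.e. representatives of all the 12 left cosets of `T` in `Φ`": every permutation of the five sums lies in
the left coset `χ_a T` of one of them. [cite: RhinViola1996, §3 p. 39] -/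
theorem rep12_covers : ∀ π : Perm (Fin 5), ∃ a : Fin 12, ∃ p : Fin 5 × Fin 2, (rep12 a)⁻¹ * π = tauSigma p := by
  unfold rep12 tauSigma; decide +kernel

/-- The same two facts phrased with `T`: distinct left cosets, covering `Φ = S₅`. [cite: RhinViola1996, §3 p. 39] -/
theorem rep12_leftCosets :
    (∀ a b : Fin 12, a ≠ b → (rep12 a)⁻¹ * rep12 b ∉ TV) ∧ ∀ π : Perm (Fin 5), ∃ a : Fin 12, (rep12 a)⁻¹ * π ∈ TV := by
  constructor
  · intro a b hab hmem
    obtain ⟨p, hp⟩ := (mem_TV_iff _).mp hmem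
    exact rep12_pairwise_inequivalent a b hab p hp.symm
  · intro π
    obtain ⟨a, p, hp⟩ := rep12_covers π
    exact ⟨a, (mem_TV_iff _).mpr ⟨p, hp.symm⟩⟩

end PhiGroup

end Literature.NumberTheory.Irrationality.RhinViola1996
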